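import Summits.Ventures.GridStability.Lyapunov.PolytopeSectorBounds
import Summits.Ventures.GridStability.Lyapunov.StructurePreservingRateRoa
import HarnessLib

/-!
# GridStability/Lyapunov/StructurePreservingPolytopeRate — «SP-RATE-POLYTOPE», part 1 (pointwise): the
# strict Lyapunov function `V_h = V + hX` of MODEL MV-3 decays at a certified rate on Vu–Turitsyn's POLYTOPE
# sublevel `{V ≤ c} ∩ {|σ + σ*| ≤ π}` from PER-EDGE ENDPOINT data (no window, no uniform sector gain)

Cell `gridfusion` (LADDER-GRIDFUSION), seat gridfusion-lyap-1 (g8); successor item of the «SP-RATE» family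
(`StructurePreservingRate*.lean`, p544339/p545614/p550672 — rate on the WINDOW `|σ| < π/2` through the uniform
gain `g(θ)` of [cite: VuTuritsyn2017, §IV-A]) on the LARGER region of ★ #91
(`StructurePreservingPolytopeRoa.lean`: `{V ≤ c} ∩ 𝒫 ∩ leaf`, `c < b_e·vtGap(σ*_e)`, [cite: VuTuritsyn2016, §IV]).
MECHANISM. A level `V ≤ c` confines every coupled line angle `yᵢⱼ = δᵢ − δⱼ` to a sub-interval
`[ℓᵢⱼ, uᵢⱼ] ∋ σ*ᵢⱼ` of its polytope interval as soon as `c < bᵢⱼ·U(ℓᵢⱼ)` and `c < bᵢⱼ·U(uᵢⱼ)`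
(`U = branchEnergy`, `bᵢⱼ·Uᵢⱼ ≤ W ≤ V`; `PolytopeSectorBounds.mem_Ioo_of_branchEnergy_le`); on that
sub-interval two ENDPOINT inequalities each certify a Bregman slope `m` (`m·Δ² ≤ 2U`) and a pairing ratio
`k ≤ 1` (`k·U ≤ Δ(sin y − sin σ*)`) (`PolytopeSectorBounds`). The certified numbers are packaged as the
`Prop`-valued record `EdgeRateCert p δ₀ c m k ℓ u` (twelve families of scalar inequalities — what an instance
checks over `ℚ`). CONSEQUENCES at a phase point `x` of the closed polytope with `V(x) ≤ c`
(`0 ≤ h`, `2hMᵢ ≤ Dᵢ` on the generators):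
* `potential_ge_mul_quadratic_vt` — `m·Q ≤ W`; `pairing_ge_mul_potential_vt` — `k·W ≤ Π`;
* `vh_le_kinetic_add_potential` — `V_h ≤ 2K + h·Σ Dᵢφᵢ² + W` (everywhere; the `W`-form of p544339's
  `vh_le_of_two_mul_le`, which matters: `W`, not `Q`, is what `Π` controls on the polytope);
* **`fderiv_vh_le_neg_mul_vt`** — with ANY leaf-Poincaré pair `Σ Dᵢφᵢ² ≤ A·Q + B·K` at `x` (`A ≥ 0`;
  closed forms p544339 / p550229, or a kernel constant) and `ρ ≥ 0` with `ρ(2 + hB) ≤ 2h`,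
  `ρ(1 + hA/m) ≤ h·k`: `DV_h(x)·F(x) ≤ −ρ·V_h(x)`;
* `vh_le_mul_phaseEnergy_vt` — `V_h ≤ C·V` for `2 + hB ≤ C`, `1 + hA/m ≤ C`.
Part 2 (`StructurePreservingPolytopeRateRoa.lean`) integrates along solutions on the ★ #91 region.
THREE COLUMNS: mathematics about MODEL MV-3 (`plan/MODEL-VALIDITY.md`; with `gen = univ` MV-2L); `ρ` is a
certified LOWER bound on the model's rate given certified per-edge data; no sentence here says a grid is
stable or well damped. One `Prop` structure (certificate format), no named fact, standard axioms.
[cite: Khalil2002, Theorem 4.10]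
-/

noncomputable section

open Set Real Finset
open Summit.Ventures.GridStability.Models.StructurePreserving
open Summit.Ventures.GridStability.Models.StructurePreserving.Params
open Summit.Ventures.GridStability.Lyapunov.PolytopeSector

namespace Summit.Ventures.GridStability.Lyapunov.StructurePreserving

variable {n : ℕ}

/-! ### The per-edge certificate -/

/-- **Per-edge endpoint certificate for the polytope rate** of structure-preserving data `p` at the
equilibrium `δ₀`, level `c`, Bregman slope `m`, pairing ratio `k`, and per-pair test angles
`ℓ i j ≤ δ₀ i − δ₀ j ≤ u i j` (only coupled pairs `bᵢⱼ ≠ 0` are constrained; `σ* = δ₀ i − δ₀ j`,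
`U(y) = branchEnergy y σ*`): the test angles lie in `[−π, π]`; the level is below `bᵢⱼ·U` at both test
angles (CONFINEMENT); `m ≤ cos σ*` and the two endpoint SLOPE inequalities; `k ≤ 1` and the two endpoint
RATIO inequalities. Every field is a scalar inequality an instance discharges by exact arithmetic.
[folklore] -/
structure EdgeRateCert (p : Params n) (δ₀ : Fin n → ℝ) (c m k : ℝ) (ℓ u : Fin n → Fin n → ℝ) : Prop where
  /-- `−π ≤ ℓᵢⱼ`. -/
  neg_pi_le : ∀ i j, p.b i j ≠ 0 → -π ≤ ℓ i j
  /-- `ℓᵢⱼ ≤ σ*ᵢⱼ`. -/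
  lo_le : ∀ i j, p.b i j ≠ 0 → ℓ i j ≤ δ₀ i - δ₀ j
  /-- `σ*ᵢⱼ ≤ uᵢⱼ`. -/
  le_hi : ∀ i j, p.b i j ≠ 0 → δ₀ i - δ₀ j ≤ u i j
  /-- `uᵢⱼ ≤ π`. -/
  le_pi : ∀ i j, p.b i j ≠ 0 → u i j ≤ π
  /-- Confinement below: `c < bᵢⱼ·U(ℓᵢⱼ)`. -/
  level_lo : ∀ i j, p.b i j ≠ 0 → c < p.b i j * branchEnergy (ℓ i j) (δ₀ i - δ₀ j)
  /-- Confinement above: `c < bᵢⱼ·U(uᵢⱼ)`. -/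
  level_hi : ∀ i j, p.b i j ≠ 0 → c < p.b i j * branchEnergy (u i j) (δ₀ i - δ₀ j)
  /-- Slope at the equilibrium: `m ≤ cos σ*ᵢⱼ`. -/
  slope_le_cos : ∀ i j, p.b i j ≠ 0 → m ≤ Real.cos (δ₀ i - δ₀ j)
  /-- Endpoint slope below: `m(σ* − ℓ) ≤ sin σ* − sin ℓ`. -/
  slope_lo : ∀ i j, p.b i j ≠ 0 →
    m * ((δ₀ i - δ₀ j) - ℓ i j) ≤ Real.sin (δ₀ i - δ₀ j) - Real.sin (ℓ i j)
  /-- Endpoint slope above: `m(u − σ*) ≤ sin u − sin σ*`. -/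
  slope_hi : ∀ i j, p.b i j ≠ 0 →
    m * (u i j - (δ₀ i - δ₀ j)) ≤ Real.sin (u i j) - Real.sin (δ₀ i - δ₀ j)
  /-- `k ≤ 1`. -/
  ratio_le_one : k ≤ 1
  /-- Endpoint ratio below: `k·U(ℓ) ≤ (ℓ − σ*)(sin ℓ − sin σ*)`. -/
  ratio_lo : ∀ i j, p.b i j ≠ 0 → k * branchEnergy (ℓ i j) (δ₀ i - δ₀ j)
    ≤ (ℓ i j - (δ₀ i - δ₀ j)) * (Real.sin (ℓ i j) - Real.sin (δ₀ i - δ₀ j))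
  /-- Endpoint ratio above: `k·U(u) ≤ (u − σ*)(sin u − sin σ*)`. -/
  ratio_hi : ∀ i j, p.b i j ≠ 0 → k * branchEnergy (u i j) (δ₀ i - δ₀ j)
    ≤ (u i j - (δ₀ i - δ₀ j)) * (Real.sin (u i j) - Real.sin (δ₀ i - δ₀ j))

namespace EdgeRateCert

variable {p : Params n} {δ₀ : Fin n → ℝ} {c m k : ℝ} {ℓ u : Fin n → Fin n → ℝ}

/-- **Confinement.** Under the certificate, at a phase point of the closed polytope (`|σ*| ≤ π/2` on
coupled pairs, well-formed `p`, `b ≥ 0`) with `V ≤ c`, every coupled line angle lies in its test interval: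
`ℓᵢⱼ ≤ δᵢ − δⱼ ≤ uᵢⱼ` (`bᵢⱼ·Uᵢⱼ ≤ W ≤ V ≤ c`, then `mem_Ioo_of_branchEnergy_le`). [folklore] -/
theorem mem_Icc (hc : EdgeRateCert p δ₀ c m k ℓ u) (hp : p.WellFormed) (hb : ∀ i j, 0 ≤ p.b i j)
    (h0 : ∀ i j, p.b i j ≠ 0 → |δ₀ i - δ₀ j| ≤ π / 2) {x : (Fin n → ℝ) × (Fin n → ℝ)}
    (hP : ∀ i j, p.b i j ≠ 0 → |(x.1 i - x.1 j) + (δ₀ i - δ₀ j)| ≤ π)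
    (hV : phaseEnergy p δ₀ x ≤ c) {i j : Fin n} (hij : p.b i j ≠ 0) :
    x.1 i - x.1 j ∈ Icc (ℓ i j) (u i j) := by
  have hbpos : 0 < p.b i j := (hb i j).lt_of_ne (Ne.symm hij)
  have hW := mul_branchEnergy_le_potential p hb hp.b_symm h0 hP i j
  have hK : 0 ≤ p.kinetic x.2 := p.kinetic_nonneg (fun a ha => (hp.M_pos a ha).le) x.2
  have hVeq : phaseEnergy p δ₀ x = p.kinetic x.2 + p.potential δ₀ x.1 := rfl
  have hU : branchEnergy (x.1 i - x.1 j) (δ₀ i - δ₀ j) ≤ c / p.b i j := by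
    rw [le_div_iff₀ hbpos, mul_comm]
    linarith
  have hℓ' : c / p.b i j < branchEnergy (ℓ i j) (δ₀ i - δ₀ j) := by
    rw [div_lt_iff₀ hbpos, mul_comm]
    exact hc.level_lo i j hij
  have hu' : c / p.b i j < branchEnergy (u i j) (δ₀ i - δ₀ j) := by
    rw [div_lt_iff₀ hbpos, mul_comm]
    exact hc.level_hi i j hij
  have h := mem_Ioo_of_branchEnergy_le (h0 i j hij) (hP i j hij) hU (hc.lo_le i j hij)
    (hc.le_hi i j hij) hℓ' hu'
  exact ⟨h.1.le, h.2.le⟩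

/-- **Bregman bound per coupled pair** on the sublevel: `(m/2)·Δᵢⱼ² ≤ Uᵢⱼ`. [folklore] -/
theorem branchEnergy_ge (hc : EdgeRateCert p δ₀ c m k ℓ u) (hp : p.WellFormed)
    (hb : ∀ i j, 0 ≤ p.b i j) (h0 : ∀ i j, p.b i j ≠ 0 → |δ₀ i - δ₀ j| ≤ π / 2)
    {x : (Fin n → ℝ) × (Fin n → ℝ)} (hP : ∀ i j, p.b i j ≠ 0 → |(x.1 i - x.1 j) + (δ₀ i - δ₀ j)| ≤ π)
    (hV : phaseEnergy p δ₀ x ≤ c) {i j : Fin n} (hij : p.b i j ≠ 0) :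
    m / 2 * ((x.1 i - x.1 j) - (δ₀ i - δ₀ j)) ^ 2 ≤ branchEnergy (x.1 i - x.1 j) (δ₀ i - δ₀ j) :=
  branchEnergy_ge_of_endpoints (hc.neg_pi_le i j hij) (hc.lo_le i j hij) (hc.le_hi i j hij)
    (hc.le_pi i j hij) (hc.slope_le_cos i j hij) (hc.slope_lo i j hij) (hc.slope_hi i j hij) _
    (hc.mem_Icc hp hb h0 hP hV hij)

/-- **Ratio bound per coupled pair** on the sublevel: `k·Uᵢⱼ ≤ Δᵢⱼ·(sin yᵢⱼ − sin σ*ᵢⱼ)`. [folklore] -/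
theorem pairing_ge (hc : EdgeRateCert p δ₀ c m k ℓ u) (hp : p.WellFormed)
    (hb : ∀ i j, 0 ≤ p.b i j) (h0 : ∀ i j, p.b i j ≠ 0 → |δ₀ i - δ₀ j| ≤ π / 2)
    {x : (Fin n → ℝ) × (Fin n → ℝ)} (hP : ∀ i j, p.b i j ≠ 0 → |(x.1 i - x.1 j) + (δ₀ i - δ₀ j)| ≤ π)
    (hV : phaseEnergy p δ₀ x ≤ c) {i j : Fin n} (hij : p.b i j ≠ 0) :
    k * branchEnergy (x.1 i - x.1 j) (δ₀ i - δ₀ j)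
      ≤ ((x.1 i - x.1 j) - (δ₀ i - δ₀ j))
        * (Real.sin (x.1 i - x.1 j) - Real.sin (δ₀ i - δ₀ j)) :=
  pairing_ge_mul_branchEnergy_of_endpoints (h0 i j hij) (hc.neg_pi_le i j hij) (hc.le_pi i j hij)
    hc.ratio_le_one (hc.ratio_lo i j hij) (hc.ratio_hi i j hij) _ (hc.mem_Icc hp hb h0 hP hV hij)

/-- **`m·Q ≤ W` on the sublevel** (termwise `bᵢⱼ·(m/2)Δᵢⱼ² ≤ bᵢⱼ·Uᵢⱼ`). [folklore] -/
theorem potential_ge_mul_quadratic_vt (hc : EdgeRateCert p δ₀ c m k ℓ u) (hp : p.WellFormed)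
    (hb : ∀ i j, 0 ≤ p.b i j) (h0 : ∀ i j, p.b i j ≠ 0 → |δ₀ i - δ₀ j| ≤ π / 2)
    {x : (Fin n → ℝ) × (Fin n → ℝ)} (hP : ∀ i j, p.b i j ≠ 0 → |(x.1 i - x.1 j) + (δ₀ i - δ₀ j)| ≤ π)
    (hV : phaseEnergy p δ₀ x ≤ c) :
    m * ((1 / 2) * ∑ i, ∑ j, p.b i j * (((x.1 i - x.1 j) - (δ₀ i - δ₀ j)) ^ 2 / 2))
      ≤ p.potential δ₀ x.1 := by
  unfold Params.potential
  rw [← mul_assoc, mul_comm m (1 / 2), mul_assoc, Finset.mul_sum]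
  refine mul_le_mul_of_nonneg_left (Finset.sum_le_sum fun i _ => ?_) (by norm_num)
  rw [Finset.mul_sum]
  refine Finset.sum_le_sum fun j _ => ?_
  by_cases hij : p.b i j = 0
  · simp [hij]
  · have h := hc.branchEnergy_ge hp hb h0 hP hV hij
    calc m * (p.b i j * (((x.1 i - x.1 j) - (δ₀ i - δ₀ j)) ^ 2 / 2))
        = p.b i j * (m / 2 * ((x.1 i - x.1 j) - (δ₀ i - δ₀ j)) ^ 2) := by ring
      _ ≤ p.b i j * branchEnergy (x.1 i - x.1 j) (δ₀ i - δ₀ j) := mul_le_mul_of_nonneg_left h (hb i j)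

/-- **`k·W ≤ Π` on the sublevel** (termwise). [folklore] -/
theorem pairing_ge_mul_potential_vt (hc : EdgeRateCert p δ₀ c m k ℓ u) (hp : p.WellFormed)
    (hb : ∀ i j, 0 ≤ p.b i j) (h0 : ∀ i j, p.b i j ≠ 0 → |δ₀ i - δ₀ j| ≤ π / 2)
    {x : (Fin n → ℝ) × (Fin n → ℝ)} (hP : ∀ i j, p.b i j ≠ 0 → |(x.1 i - x.1 j) + (δ₀ i - δ₀ j)| ≤ π)
    (hV : phaseEnergy p δ₀ x ≤ c) :
    k * p.potential δ₀ x.1 ≤ pairing p δ₀ x.1 := by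
  unfold Params.potential pairing
  rw [← mul_assoc, mul_comm k (1 / 2), mul_assoc, Finset.mul_sum]
  refine mul_le_mul_of_nonneg_left (Finset.sum_le_sum fun i _ => ?_) (by norm_num)
  rw [Finset.mul_sum]
  refine Finset.sum_le_sum fun j _ => ?_
  by_cases hij : p.b i j = 0
  · simp [hij]
  · have h := hc.pairing_ge hp hb h0 hP hV hij
    calc k * (p.b i j * branchEnergy (x.1 i - x.1 j) (δ₀ i - δ₀ j))
        = p.b i j * (k * branchEnergy (x.1 i - x.1 j) (δ₀ i - δ₀ j)) := by ring
      _ ≤ p.b i j * (((x.1 i - x.1 j) - (δ₀ i - δ₀ j))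
            * (Real.sin (x.1 i - x.1 j) - Real.sin (δ₀ i - δ₀ j))) :=
          mul_le_mul_of_nonneg_left h (hb i j)

end EdgeRateCert

/-! ### `V_h ≤ 2K + hΦ + W` everywhere -/

/-- **`V_h ≤ 2K + h·Σ Dᵢφᵢ² + W`** for `0 ≤ h` with `2hMᵢ ≤ Dᵢ` on the generators (well-formed data): from
the completed square `vh_eq` (p542074), `(ω + hφ)² ≤ 2ω² + 2h²φ²`, `h²Mᵢ ≤ hDᵢ/2`, `Dᵢ − hMᵢ ≤ Dᵢ`. The
`W`-form of p544339's `vh_le_of_two_mul_le` (there `W ≤ Q` was applied at the end). [folklore] -/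
theorem vh_le_kinetic_add_potential {p : Params n} (hp : p.WellFormed) (δ₀ : Fin n → ℝ) {h : ℝ}
    (hh : 0 ≤ h) (hhM : ∀ i ∈ p.gen, 2 * h * p.M i ≤ p.D i) (x : (Fin n → ℝ) × (Fin n → ℝ)) :
    phaseEnergy p δ₀ x + h * crossTerm p δ₀ x
      ≤ 2 * p.kinetic x.2 + h * ∑ i, p.D i * (x.1 i - δ₀ i) ^ 2 + p.potential δ₀ x.1 := by
  rw [vh_eq hp δ₀ h x]
  have hT1 : (1 / 2) * ∑ i ∈ p.gen, p.M i * (x.2 i + h * (x.1 i - δ₀ i)) ^ 2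
      ≤ 2 * p.kinetic x.2 + (h / 2) * ∑ i ∈ p.gen, p.D i * (x.1 i - δ₀ i) ^ 2 := by
    have hterm : ∀ i ∈ p.gen, (1 / 2) * (p.M i * (x.2 i + h * (x.1 i - δ₀ i)) ^ 2)
        ≤ p.M i * x.2 i ^ 2 + (h / 2) * (p.D i * (x.1 i - δ₀ i) ^ 2) := by
      intro i hi
      have hMi := (hp.M_pos i hi).le
      have hsq : (x.2 i + h * (x.1 i - δ₀ i)) ^ 2
          ≤ 2 * x.2 i ^ 2 + 2 * (h ^ 2 * (x.1 i - δ₀ i) ^ 2) := by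
        nlinarith [sq_nonneg (x.2 i - h * (x.1 i - δ₀ i))]
      have hφ2 : 0 ≤ (x.1 i - δ₀ i) ^ 2 := sq_nonneg _
      have hhM2 : h ^ 2 * p.M i ≤ h * p.D i / 2 := by nlinarith [hhM i hi]
      calc (1 / 2) * (p.M i * (x.2 i + h * (x.1 i - δ₀ i)) ^ 2)
          ≤ (1 / 2) * (p.M i * (2 * x.2 i ^ 2 + 2 * (h ^ 2 * (x.1 i - δ₀ i) ^ 2))) :=
            mul_le_mul_of_nonneg_left (mul_le_mul_of_nonneg_left hsq hMi) (by norm_num)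
        _ = p.M i * x.2 i ^ 2 + (h ^ 2 * p.M i) * (x.1 i - δ₀ i) ^ 2 := by ring
        _ ≤ p.M i * x.2 i ^ 2 + (h * p.D i / 2) * (x.1 i - δ₀ i) ^ 2 := by
            linarith [mul_le_mul_of_nonneg_right hhM2 hφ2]
        _ = p.M i * x.2 i ^ 2 + (h / 2) * (p.D i * (x.1 i - δ₀ i) ^ 2) := by ring
    have hsum := Finset.sum_le_sum hterm
    rw [← Finset.mul_sum, Finset.sum_add_distrib, ← Finset.mul_sum] at hsum
    have hK : ∑ i ∈ p.gen, p.M i * x.2 i ^ 2 = 2 * p.kinetic x.2 := by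
      unfold Params.kinetic; ring
    rw [hK] at hsum
    exact hsum
  have hgenall : ∑ i ∈ p.gen, p.D i * (x.1 i - δ₀ i) ^ 2 ≤ ∑ i, p.D i * (x.1 i - δ₀ i) ^ 2 :=
    Finset.sum_le_sum_of_subset_of_nonneg (Finset.subset_univ _)
      fun i _ _ => mul_nonneg (hp.D_pos i).le (sq_nonneg _)
  have hT2 : (1 / 2) * h * ∑ i, (p.D i - h * p.M i) * (x.1 i - δ₀ i) ^ 2
      ≤ (h / 2) * ∑ i, p.D i * (x.1 i - δ₀ i) ^ 2 := by
    have hle : ∑ i, (p.D i - h * p.M i) * (x.1 i - δ₀ i) ^ 2 ≤ ∑ i, p.D i * (x.1 i - δ₀ i) ^ 2 := by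
      refine Finset.sum_le_sum fun i _ => mul_le_mul_of_nonneg_right ?_ (sq_nonneg _)
      have hM0 : 0 ≤ p.M i := by
        by_cases hi : i ∈ p.gen
        · exact (hp.M_pos i hi).le
        · rw [hp.M_eq_zero i hi]
      nlinarith
    have := mul_le_mul_of_nonneg_left hle (show 0 ≤ h / 2 by linarith)
    linarith
  have hΦ0 : 0 ≤ ∑ i, p.D i * (x.1 i - δ₀ i) ^ 2 :=
    Finset.sum_nonneg fun i _ => mul_nonneg (hp.D_pos i).le (sq_nonneg _)
  nlinarith

/-! ### The pointwise rate and gain on the polytope sublevel -/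

/-- **Pointwise rate on the polytope sublevel.** Well-formed data, `b ≥ 0`, coupled equilibrium line angles
`|σ*| ≤ π/2`, a synchronous equilibrium `δ₀`, a certificate `EdgeRateCert p δ₀ c m k ℓ u` with `0 < m`;
`0 < h`, `2hMᵢ ≤ Dᵢ` on the generators. At a phase point `x` of the CLOSED polytope with
`V(x) ≤ c` and a leaf-Poincaré pair `Σ Dᵢφᵢ² ≤ A·Q + B·K` at `x` (`0 ≤ A`), every `ρ ≥ 0` with
`ρ(2 + hB) ≤ 2h` and `ρ(1 + hA/m) ≤ h·k` gives `DV_h(x)·F(x) ≤ −ρ·V_h(x)`. Proof: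
`−V̇_h ≥ 2hK + hΠ ≥ 2hK + hkW` (`vh_rate_eq`, `k·W ≤ Π`) and `V_h ≤ (2 + hB)K + (1 + hA/m)W`
(`V_h ≤ 2K + hΦ + W`, `Q ≤ W/m`). [cite: Khalil2002, Theorem 4.10 (hypothesis (4.26))] -/
theorem fderiv_vh_le_neg_mul_vt {p : Params n} (hp : p.WellFormed) (hb : ∀ i j, 0 ≤ p.b i j)
    {δ₀ : Fin n → ℝ} (h0 : ∀ i j, p.b i j ≠ 0 → |δ₀ i - δ₀ j| ≤ π / 2) (hδ₀ : p.IsSyncEquilibrium δ₀)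
    {c m k : ℝ} {ℓ u : Fin n → Fin n → ℝ} (hc : EdgeRateCert p δ₀ c m k ℓ u) (hm : 0 < m)
    {h : ℝ} (hh : 0 < h) (hhM : ∀ i ∈ p.gen, 2 * h * p.M i ≤ p.D i)
    {x : (Fin n → ℝ) × (Fin n → ℝ)} (hP : ∀ i j, p.b i j ≠ 0 → |(x.1 i - x.1 j) + (δ₀ i - δ₀ j)| ≤ π)
    (hV : phaseEnergy p δ₀ x ≤ c) {A B : ℝ} (hA : 0 ≤ A)
    (hPoinc : ∑ i, p.D i * (x.1 i - δ₀ i) ^ 2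
      ≤ A * ((1 / 2) * ∑ i, ∑ j, p.b i j * (((x.1 i - x.1 j) - (δ₀ i - δ₀ j)) ^ 2 / 2))
        + B * p.kinetic x.2)
    {ρ : ℝ} (hρ0 : 0 ≤ ρ) (hρK : ρ * (2 + h * B) ≤ 2 * h) (hρW : ρ * (1 + h * A / m) ≤ h * k) :
    fderiv ℝ (fun y => phaseEnergy p δ₀ y + h * crossTerm p δ₀ y) x (phaseField p x)
      ≤ -ρ * (phaseEnergy p δ₀ x + h * crossTerm p δ₀ x) := by
  set K : ℝ := p.kinetic x.2 with hK
  set W : ℝ := p.potential δ₀ x.1 with hW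
  set Qx : ℝ := (1 / 2) * ∑ i, ∑ j, p.b i j * (((x.1 i - x.1 j) - (δ₀ i - δ₀ j)) ^ 2 / 2)
    with hQx
  set Φ : ℝ := ∑ i, p.D i * (x.1 i - δ₀ i) ^ 2 with hΦ
  have hK0 : 0 ≤ K := p.kinetic_nonneg (fun i hi => (hp.M_pos i hi).le) x.2
  have hW0 : 0 ≤ W := p.potential_nonneg hb h0 hP
  have hmQ : m * Qx ≤ W := hc.potential_ge_mul_quadratic_vt hp hb h0 hP hV
  have hkW : k * W ≤ pairing p δ₀ x.1 := hc.pairing_ge_mul_potential_vt hp hb h0 hP hV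
  -- dissipation: `V̇_h ≤ −2hK − h·k·W`
  have hdiss : fderiv ℝ (fun y => phaseEnergy p δ₀ y + h * crossTerm p δ₀ y) x (phaseField p x)
      ≤ -(2 * h * K) - h * (k * W) := by
    rw [fderiv_vh_phaseField hp hδ₀ h x, vh_rate_eq x δ₀ h]
    have h1 : 0 ≤ ∑ i ∈ univ \ p.gen, p.D i * (phaseField p x).1 i ^ 2 :=
      Finset.sum_nonneg fun i _ => mul_nonneg (hp.D_pos i).le (sq_nonneg _)
    have h2 : 2 * h * K ≤ ∑ i ∈ p.gen, (p.D i - h * p.M i) * x.2 i ^ 2 := by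
      have hK2 : 2 * h * K = ∑ i ∈ p.gen, h * p.M i * x.2 i ^ 2 := by
        rw [hK]; unfold Params.kinetic
        rw [Finset.mul_sum, Finset.mul_sum]
        exact Finset.sum_congr rfl fun i _ => by ring
      rw [hK2]
      refine Finset.sum_le_sum fun i hi => mul_le_mul_of_nonneg_right ?_ (sq_nonneg _)
      linarith [hhM i hi]
    have h3 := mul_le_mul_of_nonneg_left hkW hh.le
    linarith
  -- upper bound `V_h ≤ (2 + hB)K + (1 + hA/m)W`
  have hup : phaseEnergy p δ₀ x + h * crossTerm p δ₀ x ≤ (2 + h * B) * K + (1 + h * A / m) * W := by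
    have h1 := vh_le_kinetic_add_potential hp δ₀ hh.le hhM x
    rw [← hK, ← hΦ, ← hW] at h1
    have hQW : Qx ≤ W / m := by
      rw [le_div_iff₀ hm, mul_comm]
      exact hmQ
    have h2 : h * Φ ≤ h * (A * (W / m) + B * K) := by
      refine mul_le_mul_of_nonneg_left (hPoinc.trans ?_) hh.le
      linarith [mul_le_mul_of_nonneg_left hQW hA]
    have e : h * (A * (W / m) + B * K) = (h * B) * K + (h * A / m) * W := by
      field_simp
      ring
    rw [e] at h2
    linarith
  have hfin : ρ * (phaseEnergy p δ₀ x + h * crossTerm p δ₀ x) ≤ 2 * h * K + h * (k * W) := by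
    have := mul_le_mul_of_nonneg_left hup hρ0
    have e : ρ * ((2 + h * B) * K + (1 + h * A / m) * W)
        = (ρ * (2 + h * B)) * K + (ρ * (1 + h * A / m)) * W := by ring
    rw [e] at this
    have e2 : h * (k * W) = (h * k) * W := by ring
    rw [e2]
    nlinarith [mul_le_mul_of_nonneg_right hρK hK0, mul_le_mul_of_nonneg_right hρW hW0]
  linarith

/-- **Gain on the polytope sublevel**: at a phase point of the closed polytope with `V ≤ c` and the
Poincaré pair `(A, B)` (`0 ≤ A`), every `C` with `2 + hB ≤ C` and `1 + hA/m ≤ C` gives `V_h ≤ C·V`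
(`0 ≤ h`, `2hMᵢ ≤ Dᵢ` on the generators, `0 < m`). [folklore] -/
theorem vh_le_mul_phaseEnergy_vt {p : Params n} (hp : p.WellFormed) (hb : ∀ i j, 0 ≤ p.b i j)
    {δ₀ : Fin n → ℝ} (h0 : ∀ i j, p.b i j ≠ 0 → |δ₀ i - δ₀ j| ≤ π / 2)
    {c m k : ℝ} {ℓ u : Fin n → Fin n → ℝ} (hc : EdgeRateCert p δ₀ c m k ℓ u) (hm : 0 < m)
    {h : ℝ} (hh : 0 ≤ h) (hhM : ∀ i ∈ p.gen, 2 * h * p.M i ≤ p.D i)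
    {x : (Fin n → ℝ) × (Fin n → ℝ)} (hP : ∀ i j, p.b i j ≠ 0 → |(x.1 i - x.1 j) + (δ₀ i - δ₀ j)| ≤ π)
    (hV : phaseEnergy p δ₀ x ≤ c) {A B : ℝ} (hA : 0 ≤ A)
    (hPoinc : ∑ i, p.D i * (x.1 i - δ₀ i) ^ 2
      ≤ A * ((1 / 2) * ∑ i, ∑ j, p.b i j * (((x.1 i - x.1 j) - (δ₀ i - δ₀ j)) ^ 2 / 2))
        + B * p.kinetic x.2)
    {C : ℝ} (hCK : 2 + h * B ≤ C) (hCW : 1 + h * A / m ≤ C) :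
    phaseEnergy p δ₀ x + h * crossTerm p δ₀ x ≤ C * phaseEnergy p δ₀ x := by
  set K : ℝ := p.kinetic x.2 with hK
  set W : ℝ := p.potential δ₀ x.1 with hW
  set Qx : ℝ := (1 / 2) * ∑ i, ∑ j, p.b i j * (((x.1 i - x.1 j) - (δ₀ i - δ₀ j)) ^ 2 / 2)
    with hQx
  set Φ : ℝ := ∑ i, p.D i * (x.1 i - δ₀ i) ^ 2 with hΦ
  have hK0 : 0 ≤ K := p.kinetic_nonneg (fun i hi => (hp.M_pos i hi).le) x.2
  have hW0 : 0 ≤ W := p.potential_nonneg hb h0 hP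
  have hmQ : m * Qx ≤ W := hc.potential_ge_mul_quadratic_vt hp hb h0 hP hV
  have hup : phaseEnergy p δ₀ x + h * crossTerm p δ₀ x ≤ (2 + h * B) * K + (1 + h * A / m) * W := by
    have h1 := vh_le_kinetic_add_potential hp δ₀ hh hhM x
    rw [← hK, ← hΦ, ← hW] at h1
    have hQW : Qx ≤ W / m := by
      rw [le_div_iff₀ hm, mul_comm]
      exact hmQ
    have h2 : h * Φ ≤ h * (A * (W / m) + B * K) := by
      refine mul_le_mul_of_nonneg_left (hPoinc.trans ?_) hh
      linarith [mul_le_mul_of_nonneg_left hQW hA]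
    have e : h * (A * (W / m) + B * K) = (h * B) * K + (h * A / m) * W := by
      field_simp
      ring
    rw [e] at h2
    linarith
  have hV : phaseEnergy p δ₀ x = K + W := rfl
  rw [hV, mul_add]
  nlinarith [mul_le_mul_of_nonneg_right hCK hK0, mul_le_mul_of_nonneg_right hCW hW0]

end Summit.Ventures.GridStability.Lyapunov.StructurePreserving

end
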